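import Mathlib.Analysis.SpecialFunctions.Pow.Real
import Mathlib.NumberTheory.Real.Irrational
import Mathlib.RingTheory.Algebraic.Basic
import Literature.NumberTheory.Transcendental.RoyCriterion
import HarnessLib
import HarnessLib.Audit

/-!
# Gelfond's power tower conjecture (real algebraic bases) and its derivation from Schanuel

Topic `Literature/NumberTheory/Transcendental`. Two `Prop`-valued declarations, no proofs:

* `GelfondPowerTowerConjectureReal` — OPEN CONJECTURE. Marques–Sondow 2012, §1, "Gelfond's Power
  Tower Conjecture" (their corrected special case of the second of the two extensions of the
  Gelfond–Schneider theorem announced without proof by Gelfond, C. R. Acad. Sci. Paris 199 (1934)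
  259): "Let `ω ≠ 0` and `α` be algebraic numbers, with `α` irrational. Then when `z := e^ω` and
  when `z := α`, the power tower of `z` of order `k ≥ 2`, `^k z := z^(z^(⋰^z))` (`k` copies), is
  transcendental. In fact, when `z := e^ω` the numbers `^1 z, ^2 z, ^3 z, …` are algebraically
  independent, as are `^2 z, ^3 z, ^4 z, …` when `z := α`." Registered here is the TRANSCENDENCE
  clause of the `z := α` part for REAL POSITIVE algebraic irrational bases `x`, where the tower is
  the honest real number `(fun y => x ^ y)^[k] 1` (`Real.rpow` iterated `k` times from `1`, so
  `^1 x = x`, `^2 x = x ^ x`, `^3 x = x ^ (x ^ x)`; for `x > 0` this is the principal-branch value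
  of the complex tower). The case `k = 2` is the Gelfond–Schneider theorem (Hilbert's seventh
  problem, `√2^√2`; tree: `Literature.NumberTheory.Transcendental.gelfond_schneider_holds`); from
  `k = 3` on (e.g. `√2^(√2^√2) = 1.7608…`) nothing unconditional is in print — the exponent
  `^(k-1) x` is transcendental, outside Gelfond–Schneider / Baker / six exponentials. Status: open
  (Marques–Sondow 2012 give only a conditional proof, Thm 1 below; no proof and no counterexample
  is in print). Users keep it as an explicit hypothesis / target; it is the target
  `GelfondRealTowers` of the `Schanuel` route `GelfondTowers`.
* `MarquesSondow2012_thm1_real` — NAMED FACT (conditional theorem). Marques–Sondow 2012, Thm 1: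
  "Assume the Schanuel Subset Conjecture. Then Gelfond's Power Tower Conjecture is also true.
  Moreover, under the weaker hypothesis that `α` is an algebraic number but not a rational integer,
  the power tower `^m α` of order `m ≥ 3` is transcendental and the numbers
  `log α, ^3 α, ^4 α, ^5 α, …` are algebraically independent."; and ibid. §1, after the statement of
  the Schanuel Subset Conjecture (SSC): "Now, if SC is true, then we have
  trdeg_ℚ ℚ(β₁,…,βₙ) = trdeg_ℚ ℚ(α₁,…,αₙ,e^{α₁},…,e^{αₙ}) ≥ n, and so β₁,…,βₙ are algebraically
  independent. Therefore, SC implies SSC." Hence Schanuel's conjecture implies Gelfond's Power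
  Tower Conjecture; we record this consequence under SCHANUEL'S CONJECTURE in the tree's rank-wise
  format `∀ l, SchanuelRank l` (= `Literature.Periods.SchanuelConjecture` = the `Schanuel` summit,
  definitionally), restricted to the real-base transcendence clause above. (Proof in print, §2
  "Proof for z := α", Case 2: Gelfond–Schneider makes `1, α, α^α` ℚ-linearly independent, SSC at
  `{log α, α log α, α^α log α, α, α^α, α^(α^α)}` gives the algebraic independence of
  `log α, ^2 α, ^3 α`, then induction on the height.) It grounds the support item
  `Summit.Schanuel.Schanuel.Theses.GelfondTowers.SchanuelImpliesTowers` (that item is this fact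
  verbatim, `Schanuel ↔ ∀ l, SchanuelRank l` being `Iff.rfl`).

## What is NOT here

The `z := e^ω` part and the algebraic-independence clauses of the conjecture (they need a choice
of tower for complex bases and `AlgebraicIndependent` bookkeeping; not wanted by any item yet); the
Schanuel Subset Conjecture itself (Marques–Sondow ask whether SSC ⟺ SC, their Question 1 — open);
the infinite power tower `h(x)` (`x^h = h`; Sondow–Marques 2010, Appendix, and
Kobayashi–Saito–Takeda 2023 — all consequences of Gelfond–Schneider / Hermite–Lindemann, provable
from the tree when wanted). Nothing here is proved: both declarations are `Prop`s.

## References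

* [MarquesSondow2012] D. Marques, J. Sondow, *The Schanuel Subset Conjecture implies Gelfond's Power
  Tower Conjecture*, arXiv:1212.6931 (2012), §1 (conjecture, SC ⟹ SSC) and Thm 1, §2 (proof)
  (lit key paper:arxiv-1212.6931, pp. 3–5 read 2026-08-15).
* [SondowMarques2010] J. Sondow, D. Marques, *Algebraic and transcendental solutions of some
  exponential equations*, Ann. Math. Inform. 37 (2010) 151–164 = arXiv:1108.6096, Lemma 2.1,
  Prop. 1, Appendix (infinite towers).
* [Gelfond1934] A. O. Gelfond, C. R. Acad. Sci. Paris 199 (1934) 259 (the announcement).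
-/

noncomputable section

namespace Literature.NumberTheory.Transcendental

/-- OPEN CONJECTURE — **Gelfond's power tower conjecture, real algebraic irrational base,
transcendence form** (Marques–Sondow 2012, §1 "Gelfond's Power Tower Conjecture", the `z := α`
part, for real `α = x > 0`): for every real algebraic irrational `x > 0` and every `k ≥ 2` the power
tower of order `k`, `^k x = x^(x^(⋰^x))` (`k` copies) — in Lean the `k`-th iterate of
`y ↦ x ^ y` (`Real.rpow`) started at `1` — is transcendental. Printed: "Let `ω ≠ 0` and `α` be
algebraic numbers, with `α` irrational. Then when `z := e^ω` and when `z := α`, the power tower of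
`z` of order `k ≥ 2` … is transcendental." `k = 2` is Gelfond–Schneider; open from `k = 3`
(`√2^(√2^√2)`). Registered as an open statement (CONVENTIONS §4): no `_holds` is to be expected;
it is the target `GelfondRealTowers` of route `Schanuel/GelfondTowers` verbatim.
[cite: MarquesSondow2012, §1, Gelfond's Power Tower Conjecture (case z := α, α real positive)] -/
@[conjecture] def GelfondPowerTowerConjectureReal : Prop :=
  ∀ x : ℝ, 0 < x → IsAlgebraic ℚ x → Irrational x → ∀ k : ℕ, 2 ≤ k →
    Transcendental ℚ ((fun y : ℝ => x ^ y)^[k] 1)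

/-- NAMED FACT — **Schanuel's conjecture implies Gelfond's power tower conjecture**
(Marques–Sondow 2012, Thm 1: "Assume the Schanuel Subset Conjecture. Then Gelfond's Power Tower
Conjecture is also true. Moreover, under the weaker hypothesis that `α` is an algebraic number but
not a rational integer, the power tower `^m α` of order `m ≥ 3` is transcendental and the numbers
`log α, ^3 α, ^4 α, ^5 α, …` are algebraically independent."; together with §1, "Therefore, SC
implies SSC."). Stated under Schanuel's conjecture in the rank-wise format
`∀ l, SchanuelRank l` (`= Literature.Periods.SchanuelConjecture`, definitionally) and restricted to
the real-base transcendence clause `GelfondPowerTowerConjectureReal`. Unproved in the tree; users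
take `(h : MarquesSondow2012_thm1_real)`. Grounds
`Summit.Schanuel.Schanuel.Theses.GelfondTowers.SchanuelImpliesTowers` (verbatim).
[cite: MarquesSondow2012, Thm 1 with §1 (SC ⟹ SSC); proof §2, Case 2] -/
def MarquesSondow2012_thm1_real : Prop :=
  (∀ l, SchanuelRank l) → GelfondPowerTowerConjectureReal

end Literature.NumberTheory.Transcendental
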